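import Mathlib
import Summits.KontsevichZagierPeriods.Zeta5Search.BrickTwistedHarmonicTwo
import Summits.KontsevichZagierPeriods.Zeta5Search.BrickDenominatorsAllC

/-!
# BrickDenominatorsAllCTwo — the prime `2` for the `C`-twisted constant terms, and KRATTENTHALER–RIVOAL'S THÉORÈME 1 for the
symmetric very-well-poised bricks `r = 1`, `A` even, EVERY `C ≥ 0`, EXACTLY AS PRINTED, at every prime:
`d_n^{A−l−1}·p_{l,n}((−1)^A) ∈ ℤ` (`1 ≤ l ≤ A−1`) and `2·d_n^{A+C−1}·p_{0,C,n}((−1)^A) ∈ ℤ` (cell `pub-zeta5`, seat ct-1 g45)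

HONEST FRAMING: systematic search; no irrationality claim unless certified.  INTEGRALITY of the rational coefficients of the
very-well-poised brick linear forms `Σ_{k≥1}(1/C!)R_n^{(C)}(k) = p_{0,C,n}(1) + (−1)^CΣ_l binom(C+l−1,l−1)p_{l,n}(1)ζ(C+l)`,
`R_n(t) = n!^{A−2B}(t + n/2)(t−n)_n^B(t+n+1)_n^B/(t)_{n+1}^A` — Krattenthaler–Rivoal, *Hypergéométrie et fonction zêta de Riemann*,
Mem. AMS **186** (2007) no. 875, §3 Théorème 1 (arXiv:math/0311114 p. 8), a theorem in print since 2007 (their proof: Andrews's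
multisum identity, §5), reproduced here for `r = 1` and `A` even by the cell's digit induction: clause (i) and `C = 0` by zi-eng
(`BrickDenominators`) and ct-1 g44 (`BrickDenominatorsTwo`); clause (ii) for every `C` at odd primes by ct-1 g45's twisted
PROPOSITION H^∞ (`BrickDenominatorsAllC`); at the prime `2` (this file) by the centre split of the twisted cell,
`Z^{(w,C+1)}_K = Z̃^{(w(·−1),C)}_K + (n/2 − K)·Z̃^{(w,C+1)}_K` (`w(0) = 0`), and the twisted PROPOSITION H at `2` with the weight
`n − 2k` (`BrickTwistedHarmonicTwo`) — the printed factor `2` pays for the `½`.  WHAT THIS IS NOT: `r ≥ 2`, odd `A` and the general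
(asymmetric) denominators conjecture are untouched; the named fact `KrattenthalerRivoal2007.theoreme1` (ALL `A ≥ 2`, `r ≥ 0`) is NOT
discharged — `theoreme1_r_one_even` below is exactly its body at `r = 1` under the extra hypothesis `Even A`; nothing about the
arithmetic nature of `ζ(5)`/`ζ(3)`; no `γ` / `μ` / denominator-law / record statement; records in print UNMOVED.  Theorems only.

* `twist_one_eq` — the centre factor pole by pole for the twisted cell (`cell_one_eq`, `cell_one_top`; `w(0) = 0`);
* `level_two_twist`, `padicValuation_two_mul_lcmUpto_pow_mul_twist_le` — `v₂(2·d_n^{A+C}·Σ_K Z^{(w,C+1)}_K(n)) ≤ 1`;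
* `theoreme1_ii_two_pos`, `theoreme1_ii_two_allC` — `v₂(2·d_n^{A+C−1}·p_{0,C,n}((−1)^A)) ≤ 1` for `C ≥ 1`, resp. every `C`;
* **`theoreme1_ii_allC`** — `2·d_n^{A+C−1}·p_{0,C,n}((−1)^A) ∈ ℤ` for `A` even, `1 ≤ B`, `2B ≤ A`, EVERY `C`, every `n`, all data `c`;
* **`theoreme1_r_one_allC`**, **`theoreme1_r_one_even`** — clauses (i) and (ii) together; the latter in the binder shape of
  `KrattenthalerRivoal2007.theoreme1` with `r = 1` and `Even A` added.
DATA (ct-1 g44's desk `alg/twistC.py`, exact): the factor `2` of (ii) is used for `(4,1)` at `C = 1, 2`, `(6,1)` at `C = 3`, `(8,3)` at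
`C = 3` (at `n` = powers of `2`), `n ≤ 16`.
-/

namespace Summit.KontsevichZagierPeriods.Zeta5Search.BrickDenominatorsAllCTwo

open Finset Nat WithZero
open Summit.KontsevichZagierPeriods.Zeta5Search.BrickLaurent (cell)
open Summit.KontsevichZagierPeriods.Zeta5Search.BrickHarmonicBlocks (hsum)
open Summit.KontsevichZagierPeriods.Zeta5Search.BrickResidueLawTwo (padicValuation_two padicValuation_two_pow)
open Summit.KontsevichZagierPeriods.Zeta5Search.BrickDenominatorsTwo (cell_one_eq cell_one_top padicValuation_two_pow_mul_cell_le
  padicValuation_two_pow_mul_hsum_le padicValuation_lcmUpto_pow_mul theoreme1_two theoreme1_r_one)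
open Summit.KontsevichZagierPeriods.Zeta5Search.BrickTwistedHarmonicTwo (propositionH_two_twist_linear)
open Summit.KontsevichZagierPeriods.Zeta5Search.BrickDenominatorsAllC (pZero_one_eq_twist padicValuation_natCast_choose_le
  theoreme1_ii_odd_prime_allC)
open Summit.KontsevichZagierPeriods.Zeta5Search.Zudilin2002IntegralityTwoAdic (exists_int_of_forall_padicValuation_le_one)
open Literature.NumberTheory.Irrationality.KrattenthalerRivoal2007 (IsPartialFractionData pCoeff pZero)

noncomputable section

/-! ## The centre factor for the twisted cell -/

/-- **`Z^{(w,C+1)}_K(n) = Z̃^{(w(·−1),C)}_K(n) + (n/2 − K)·Z̃^{(w,C+1)}_K(n)`** for weights with `w(0) = 0` (`1 ≤ A`):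
the centre factor `t + n/2 = (t + K) + (n/2 − K)` pole by pole (`c_{K,s} = c̃_{K,s+1} + (n/2 − K)c̃_{K,s}`), the order shift absorbed
by `H^{(s+C+1)} = H^{((s+1)+C)}`. -/
theorem twist_one_eq {A B : ℕ} (hA1 : 1 ≤ A) (n K C : ℕ) (w : ℕ → ℚ) (hw0 : w 0 = 0) :
    ∑ s ∈ Icc 1 A, w s * (cell A B 1 n K s * hsum (s + (C + 1)) K) =
      ∑ s ∈ Icc 1 A, w (s - 1) * (cell A B 0 n K s * hsum (s + C) K) +
        ((n : ℚ) / 2 - K) * ∑ s ∈ Icc 1 A, w s * (cell A B 0 n K s * hsum (s + (C + 1)) K) := by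
  obtain ⟨a, rfl⟩ : ∃ a, A = a + 1 := ⟨A - 1, by omega⟩
  rw [Finset.sum_Icc_succ_top (by omega : 1 ≤ a + 1) (fun s => w s * (cell (a + 1) B 1 n K s * hsum (s + (C + 1)) K)),
    Finset.sum_Icc_succ_top (by omega : 1 ≤ a + 1) (fun s => w s * (cell (a + 1) B 0 n K s * hsum (s + (C + 1)) K)),
    cell_one_top n K]
  have hbody : ∑ s ∈ Icc 1 a, w s * (cell (a + 1) B 1 n K s * hsum (s + (C + 1)) K) =
      ∑ s ∈ Icc 1 a, w s * (cell (a + 1) B 0 n K (s + 1) * hsum (s + 1 + C) K) +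
        ((n : ℚ) / 2 - K) * ∑ s ∈ Icc 1 a, w s * (cell (a + 1) B 0 n K s * hsum (s + (C + 1)) K) := by
    rw [Finset.mul_sum, ← Finset.sum_add_distrib]
    refine Finset.sum_congr rfl fun s hs => ?_
    rw [cell_one_eq n K (by have := (mem_Icc.1 hs).2; omega : s + 1 ≤ a + 1), show s + (C + 1) = s + 1 + C by ring]
    ring
  have hshift : ∑ s ∈ Icc 1 a, w s * (cell (a + 1) B 0 n K (s + 1) * hsum (s + 1 + C) K) =
      ∑ s ∈ Icc 1 (a + 1), w (s - 1) * (cell (a + 1) B 0 n K s * hsum (s + C) K) := by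
    rw [Finset.Icc_eq_cons_Ioc (by omega : 1 ≤ a + 1), Finset.sum_cons, Nat.sub_self, hw0, zero_mul, zero_add]
    refine Finset.sum_nbij' (· + 1) (· - 1) (fun s hs => ?_) (fun s hs => ?_) (fun s _ => by simp) (fun s hs => ?_)
      (fun s _ => by rw [Nat.add_sub_cancel])
    · have := mem_Icc.1 hs; exact mem_Ioc.2 ⟨by omega, by omega⟩
    · have := mem_Ioc.1 hs; exact mem_Icc.2 ⟨by omega, by omega⟩
    · have := mem_Ioc.1 hs; omega
  rw [hbody, hshift]
  ring

/-! ## At the prime `2` -/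

section two

variable {A B : ℕ} (hA : Even A) (hB : 1 ≤ B) (hAB : 2 * B ≤ A) {C : ℕ} {w : ℕ → ℚ}
  (hw : ∀ s, Rat.padicValuation 2 (w s) ≤ 1) (hw0 : w 0 = 0)
include hA hB hAB hw hw0

/-- **Level form at `2`**: for `n < 2^{ℓ+1}`, `v₂(2·2^{ℓ(A+C)}·Σ_{K≤n} Z^{(w,C+1)}_K(n)) ≤ 1` — the shifted half termwise, the moment
`½Σ(n−2K)Z̃^{(w,C+1)}_K` by the twisted PROPOSITION H at `2` (the `2` pays for the `½`). -/
theorem level_two_twist {ℓ n : ℕ} (hn : n < 2 ^ (ℓ + 1)) :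
    Rat.padicValuation 2 (2 * ((2 : ℚ) ^ (ℓ * (A + C)) * ∑ K ∈ range (n + 1),
      ∑ s ∈ Icc 1 A, w s * (cell A B 1 n K s * hsum (s + (C + 1)) K))) ≤ 1 := by
  have hA1 : 1 ≤ A := by omega
  have htwo : (2 : ℚ) ^ (ℓ * (A + (C + 1))) = (2 : ℚ) ^ (ℓ * (A + C)) * (2 : ℚ) ^ ℓ := by
    rw [← pow_add, show ℓ * (A + C) + ℓ = ℓ * (A + (C + 1)) by ring]
  rw [Finset.sum_congr rfl fun K _ => twist_one_eq hA1 n K C w hw0, Finset.sum_add_distrib, mul_add, mul_add]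
  refine Valuation.map_add_le _ ?_ ?_
  · -- the shifted half, termwise
    rw [Finset.mul_sum, Finset.mul_sum]
    refine Valuation.map_sum_le _ fun K hK => ?_
    have hKn : K ≤ n := by have := mem_range.1 hK; omega
    rw [Finset.mul_sum, Finset.mul_sum]
    refine Valuation.map_sum_le _ fun s hs => ?_
    have hs' := mem_Icc.1 hs
    rw [show (2 : ℚ) * ((2 : ℚ) ^ (ℓ * (A + C)) * (w (s - 1) * (cell A B 0 n K s * hsum (s + C) K))) =
      2 * (w (s - 1) * ((((2 : ℚ) ^ (ℓ * (A - s)) * cell A B 0 n K s)) * ((2 : ℚ) ^ (ℓ * (s + C)) * hsum (s + C) K))) by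
        rw [show ℓ * (A + C) = ℓ * (A - s) + ℓ * (s + C) by rw [← Nat.mul_add]; congr 1; omega, pow_add]; ring,
      map_mul, map_mul, map_mul]
    exact mul_le_one' (by rw [padicValuation_two, ← exp_zero, exp_le_exp]; norm_num) (mul_le_one' (hw _)
      (mul_le_one' (padicValuation_two_pow_mul_cell_le hAB hn hKn s) (padicValuation_two_pow_mul_hsum_le hn hKn (s + C))))
  · -- the first antisymmetric moment: twisted PROPOSITION H at `2`, weight `n − 2K`
    have hS := propositionH_two_twist_linear hA hB hAB (C := C + 1) hw ℓ n hn
    set S := ∑ k ∈ range (n + 1), ((n : ℚ) - 2 * k) * ((2 : ℚ) ^ (ℓ * (A + (C + 1))) *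
      ∑ s ∈ Icc 1 A, w s * (cell A B 0 n k s * hsum (s + (C + 1)) k)) with hSdef
    have h2e : (2 : ℚ) ^ (ℓ * (A + (C + 1))) ≠ 0 := pow_ne_zero _ two_ne_zero
    have hW : ∑ K ∈ range (n + 1), ((n : ℚ) / 2 - K) * ∑ s ∈ Icc 1 A, w s * (cell A B 0 n K s * hsum (s + (C + 1)) K) =
        2⁻¹ * ((((2 : ℚ) ^ (ℓ * (A + (C + 1))))⁻¹) * S) := by
      rw [hSdef, Finset.mul_sum, Finset.mul_sum]
      refine Finset.sum_congr rfl fun K _ => ?_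
      field_simp
    rw [hW, htwo, mul_inv]
    rw [show (2 : ℚ) * ((2 : ℚ) ^ (ℓ * (A + C)) * (2⁻¹ * (((2 : ℚ) ^ (ℓ * (A + C)))⁻¹ * ((2 : ℚ) ^ ℓ)⁻¹ * S))) =
      ((2 : ℚ) ^ ℓ)⁻¹ * S by field_simp]
    rw [map_mul, map_inv₀, padicValuation_two_pow, ← exp_neg, neg_neg]
    calc exp (ℓ : ℤ) * Rat.padicValuation 2 S ≤ exp (ℓ : ℤ) * exp (-(ℓ : ℤ)) := mul_le_mul' le_rfl hS
      _ = 1 := by rw [← exp_add, ← exp_zero]; congr 1; ring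

/-- **`v₂(2·d_n^{A+C}·Σ_{K≤n} Z^{(w,C+1)}_K(n)) ≤ 1`** for every `n` (`d_n = lcm(1,…,n)`; full kernel `(A,B,1)`, `A` even, `1 ≤ B ≤ A/2`,
`w` `2`-integral with `w(0) = 0`). -/
theorem padicValuation_two_mul_lcmUpto_pow_mul_twist_le (n : ℕ) :
    Rat.padicValuation 2 (2 * (((Nat.lcmUpto n : ℕ) : ℚ) ^ (A + C) * ∑ K ∈ range (n + 1),
      ∑ s ∈ Icc 1 A, w s * (cell A B 1 n K s * hsum (s + (C + 1)) K))) ≤ 1 := by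
  rw [map_mul, padicValuation_lcmUpto_pow_mul, ← map_mul]
  exact level_two_twist hA hB hAB hw hw0 (Nat.lt_pow_succ_log_self one_lt_two n)

end two

/-! ## Krattenthaler–Rivoal's Théorème 1 (ii) for every `C` -/

section KR

variable {A B : ℕ} (hA : Even A) (hB : 1 ≤ B) (hAB : 2 * B ≤ A)
include hA hB hAB

/-- **Théorème 1 (ii) at the prime `2` for `C ≥ 1`** (`r = 1`, `A` even): `v₂(2·d_n^{A+C−1}·p_{0,C,n}((−1)^A)) ≤ 1`. -/
theorem theoreme1_ii_two_pos {C : ℕ} (hC : 1 ≤ C) {n : ℕ} {c : ℕ → ℕ → ℚ} (hc : IsPartialFractionData n A B 1 c) :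
    Rat.padicValuation 2 (2 * ((Nat.lcmUpto n : ℕ) : ℚ) ^ (A + C - 1) * pZero n A C c ((-1) ^ A)) ≤ 1 := by
  obtain ⟨C, rfl⟩ : ∃ C', C = C' + 1 := ⟨C - 1, by omega⟩
  rw [hA.neg_one_pow, pZero_one_eq_twist hAB (by omega) hc (C + 1), show A + (C + 1) - 1 = A + C by omega]
  set S := ∑ K ∈ range (n + 1), ∑ s ∈ Icc 1 A,
    (Nat.choose (s + (C + 1) - 1) (C + 1) : ℚ) * (cell A B 1 n K s * hsum (s + (C + 1)) K) with hS
  rw [show (2 : ℚ) * ((Nat.lcmUpto n : ℕ) : ℚ) ^ (A + C) * (-(-1) ^ (C + 1) * S) =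
    (-(-1) ^ (C + 1)) * (2 * (((Nat.lcmUpto n : ℕ) : ℚ) ^ (A + C) * S)) by ring, map_mul, Valuation.map_neg, map_pow,
    Valuation.map_neg, Valuation.map_one, one_pow, one_mul]
  exact padicValuation_two_mul_lcmUpto_pow_mul_twist_le hA hB hAB (w := fun s => (Nat.choose (s + (C + 1) - 1) (C + 1) : ℚ))
    (fun s => padicValuation_natCast_choose_le _ _) (by simp [Nat.choose_succ_self]) n

/-- **Théorème 1 (ii) at the prime `2` for EVERY `C`** (`C = 0`: ct-1 g44's `BrickDenominatorsTwo.theoreme1_two`). -/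
theorem theoreme1_ii_two_allC (C : ℕ) {n : ℕ} {c : ℕ → ℕ → ℚ} (hc : IsPartialFractionData n A B 1 c) :
    Rat.padicValuation 2 (2 * ((Nat.lcmUpto n : ℕ) : ℚ) ^ (A + C - 1) * pZero n A C c ((-1) ^ A)) ≤ 1 := by
  rcases C with _ | C
  · exact (theoreme1_two hA hB hAB hc).2
  · exact theoreme1_ii_two_pos hA hB hAB (by omega) hc

/-- **KRATTENTHALER–RIVOAL 2007, THÉORÈME 1 (ii), for `r = 1`, `A` even, `1 ≤ B`, `2B ≤ A` and EVERY `C ≥ 0` — exactly as printed,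
as a theorem of the tree**: `2·d_n^{A+C−1}·p_{0,C,n}((−1)^A) ∈ ℤ` for every `n` and all partial-fraction data `c` of `R_{n,A,B,1}`
(`d_n = lcm(1,…,n)`).  Odd primes: `BrickDenominatorsAllC.theoreme1_ii_odd_prime_allC`; the prime `2`: `theoreme1_ii_two_allC`.
PROOF ROUTE ≠ PRINT: the cell's digit induction for the `C`-twisted harmonic cells.
[Krattenthaler–Rivoal, Mem. AMS 186 (2007) no. 875, §3 Théorème 1 (ii); arXiv:math/0311114 p. 8] -/
theorem theoreme1_ii_allC (C : ℕ) {n : ℕ} {c : ℕ → ℕ → ℚ} (hc : IsPartialFractionData n A B 1 c) :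
    ∃ z : ℤ, 2 * ((Nat.lcmUpto n : ℕ) : ℚ) ^ (A + C - 1) * pZero n A C c ((-1) ^ A) = z := by
  refine exists_int_of_forall_padicValuation_le_one fun p hp => ?_
  by_cases hp2 : p = 2
  · subst hp2; exact theoreme1_ii_two_allC hA hB hAB C hc
  · exact @theoreme1_ii_odd_prime_allC p ⟨hp⟩ hp2 A B hA hB hAB C n c hc

/-- **Théorème 1 for `r = 1`, `A` even, `1 ≤ B`, `2B ≤ A`, every `C`, both clauses**: (i) `d_n^{A−l−1}·p_{l,n}((−1)^A) ∈ ℤ`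
(`1 ≤ l ≤ A − 1`; zi-eng + ct-1 g44) and (ii) `2·d_n^{A+C−1}·p_{0,C,n}((−1)^A) ∈ ℤ`. -/
theorem theoreme1_r_one_allC (C : ℕ) {n : ℕ} {c : ℕ → ℕ → ℚ} (hc : IsPartialFractionData n A B 1 c) :
    (∀ l : ℕ, 1 ≤ l → l + 1 ≤ A →
        ∃ z : ℤ, ((Nat.lcmUpto n : ℕ) : ℚ) ^ (A - l - 1) * pCoeff n c l ((-1) ^ A) = z) ∧
      ∃ z : ℤ, 2 * ((Nat.lcmUpto n : ℕ) : ℚ) ^ (A + C - 1) * pZero n A C c ((-1) ^ A) = z :=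
  ⟨(theoreme1_r_one hA hB hAB hc).1, theoreme1_ii_allC hA hB hAB C hc⟩

end KR

/-- **The `r = 1`, `A` even slice of the named fact `KrattenthalerRivoal2007.theoreme1`, in its binder shape** (with `Even A` added;
`2·B·1 < A` implies `2B ≤ A`): for all `n`, `A ≥ 2` even, `B ≥ 1`, `C`, and all partial-fraction data `c` of `R_{n,A,B,1}`,
clauses (i) and (ii) hold.  The fact itself (every `A ≥ 2`, every `r ≥ 0`) is NOT discharged. -/
theorem theoreme1_r_one_even :
    ∀ (n A B C : ℕ), 2 ≤ A → Even A → 1 ≤ B → 2 * B * 1 < A →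
      ∀ c : ℕ → ℕ → ℚ, IsPartialFractionData n A B 1 c →
        (∀ l : ℕ, 1 ≤ l → l + 1 ≤ A →
            ∃ z : ℤ, ((Nat.lcmUpto n : ℕ) : ℚ) ^ (A - l - 1) * pCoeff n c l ((-1) ^ A) = z) ∧
          ∃ z : ℤ, 2 * ((Nat.lcmUpto n : ℕ) : ℚ) ^ (A + C - 1) * pZero n A C c ((-1) ^ A) = z :=
  fun _ _ _ C _ hA hB hBA _ hc => theoreme1_r_one_allC hA hB (by omega) C hc

end

end Summit.KontsevichZagierPeriods.Zeta5Search.BrickDenominatorsAllCTwo
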